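import Summits.AtomisticToContinuum.HydrodynamicLimit.Theses.InformationPercolationEngine
import Literature.Analysis.FluidPDE.HardSphereBoundaryFluxEq

/-!
# Crux-ideate r2 k5, crux `KickIsotropyInfo` (stmt-AtomisticToContinuum-13478): sketch file of the
idea card `odd-parity-hemisphere-confinement`

Three checkable pieces of the card, over existing declarations:

* §1 **Hemisphere confinement** (PROVED): if the shadowing centre `c` satisfies `⟪c, n⟫ ≥ 1`
  (`‖n‖ = 1`) then every unit impact vector `ω` with `‖ω - c‖ < 1` has `⟪ω, n⟫ > 0`; and the two
  CONE CONDITIONS `⟪v - w, n⟫ ≥ 0`, `⟪u_k - w, n⟫ ≥ 0` put the whole space-time comet of the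
  identified kicker `k` (static cap at every age `u` + receding leg + incoming leg) in `{⟪·, n⟫ ≥ 1}`.
  Net: under the cone conditions the k-shadow on the sphere of impact vectors of the NEXT collision
  lies in the open hemisphere `{⟪ω, n⟫ > 0}` AT EVERY AGE — the geometric fact that makes a
  mirror-odd witness sign-definite stratum by stratum (no control of complementary strata needed
  for the identified body).
* §2 **Mirror-odd zonal kick tests have zero flux-mean** (PROVED, same reflection as the
  disprover's `integral_inner_mul_posPart_inner_eq_zero`, now for a NONLINEAR odd profile `G`):
  `∫ G(⟪ω, m⟫) (⟪b, ω⟫)₊ dσ(ω) = 0` whenever `⟪m, b⟫ = 0` — so `g(ω,v,w) = ψ(v,w)·G(⟪ω, m(v,w)⟫)`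
  with `m(v,w) ⊥ v, w` (normal of the collision plane) is an admissible kick test of the crux.
* §3 **First lemma of the `H`-construction** (TYPED as a `Prop`, not proved): the pair Palm /
  Campbell identity for collision sums of the hard-sphere flow under the invariant Gibbs law,
  written in the tree's outgoing collision chart (`HardSphereBoundaryFluxEq.lintegral_eq_boundaryFlux`):
  `E_μ Σ_{s ∈ (0,T], pair in contact at s} F(Φ_s z) = T · ∫ dW' dw dσ(ν) 1_{⟪w-v_i,ν⟫>0} ε² ⟪w-v_i,ν⟫ (ρ_μ·F)(contact config)`.
-/

open MeasureTheory Metric Real Set Filter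
open scoped InnerProductSpace ENNReal BigOperators Pointwise

namespace Summit.AtomisticToContinuum.HydrodynamicLimit.Cruxes.KickIsotropyInfo.OddParity

noncomputable section

open Literature.MathematicalPhysics.KineticTheory (T3 V3 hsDiameter sphereMeasure hardSphereKernel
  localGibbsLaw localGibbsProfile)
open Literature.Analysis.FluidPDE (HardSphereFlow Config contactSet appendParticle canonicalDensity)

/-- The flow type of the crux at reduced density `σ` and size `N + 1` (as in the disprover's file). -/
abbrev Flow (σ : ℝ) (N : ℕ) : Type :=
  HardSphereFlow (Literature.Analysis.FluidPDE.Torus.geometry (Fin 3)) (hsDiameter σ N) (N + 1)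

/-! ## §0 Surface measure: invariance under linear isometries (verbatim from the disprover's
Negative file `KickIsotropyInfoFalseOfShieldingBiasPersists.lean` §1, copied here only because that
module is not yet built on the farm; credit refuter-cdisprove-stmt-AtomisticToContinuum-13478) -/

section Sphere0

variable {E : Type*} [NormedAddCommGroup E] [InnerProductSpace ℝ E] [FiniteDimensional ℝ E]
  [MeasurableSpace E] [BorelSpace E]

def sphereMap (A : E ≃ₗᵢ[ℝ] E) (ω : sphere (0 : E) 1) : sphere (0 : E) 1 :=
  ⟨A ω, by rw [mem_sphere_zero_iff_norm, A.norm_map, norm_eq_of_mem_sphere]⟩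

omit [FiniteDimensional ℝ E] [MeasurableSpace E] [BorelSpace E] in
@[simp] theorem coe_sphereMap (A : E ≃ₗᵢ[ℝ] E) (ω : sphere (0 : E) 1) :
    (sphereMap A ω : E) = A ω := rfl

omit [FiniteDimensional ℝ E] [MeasurableSpace E] [BorelSpace E] in
theorem continuous_sphereMap (A : E ≃ₗᵢ[ℝ] E) : Continuous (sphereMap A) :=
  (A.continuous.comp continuous_subtype_val).subtype_mk _

omit [FiniteDimensional ℝ E] in
theorem measurable_sphereMap (A : E ≃ₗᵢ[ℝ] E) : Measurable (sphereMap A) :=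
  (continuous_sphereMap A).measurable

omit [FiniteDimensional ℝ E] [MeasurableSpace E] [BorelSpace E] in
theorem sphereMap_sphereMap_symm (A : E ≃ₗᵢ[ℝ] E) (η : sphere (0 : E) 1) :
    sphereMap A (sphereMap A.symm η) = η :=
  Subtype.ext (A.apply_symm_apply η)

theorem sphereMeasure_map_sphereMap (A : E ≃ₗᵢ[ℝ] E) :
    (sphereMeasure : Measure (sphere (0 : E) 1)).map (sphereMap A) = sphereMeasure := by
  refine Measure.ext fun s hs => ?_
  rw [Measure.map_apply (measurable_sphereMap A) hs,
    Literature.MathematicalPhysics.KineticTheory.sphereMeasure,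
    Measure.toSphere_apply' _ (measurable_sphereMap A hs), Measure.toSphere_apply' _ hs]
  congr 1
  have hset : (Ioo (0 : ℝ) 1 • (((↑) : sphere (0 : E) 1 → E) '' (sphereMap A ⁻¹' s))) =
      A ⁻¹' (Ioo (0 : ℝ) 1 • (((↑) : sphere (0 : E) 1 → E) '' s)) := by
    ext x
    simp only [Set.mem_smul, Set.mem_image, Set.mem_preimage]
    constructor
    · rintro ⟨r, hr, y, ⟨ω, hω, rfl⟩, rfl⟩
      refine ⟨r, hr, (sphereMap A ω : E), ⟨sphereMap A ω, hω, rfl⟩, ?_⟩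
      rw [coe_sphereMap, LinearIsometryEquiv.map_smul]
    · rintro ⟨r, hr, y, ⟨η, hη, rfl⟩, h⟩
      refine ⟨r, hr, (sphereMap A.symm η : E), ⟨sphereMap A.symm η, ?_, rfl⟩, ?_⟩
      · show sphereMap A (sphereMap A.symm η) ∈ s
        rw [sphereMap_sphereMap_symm]; exact hη
      · apply A.injective
        rw [LinearIsometryEquiv.map_smul, coe_sphereMap, A.apply_symm_apply]
        exact h
  rw [hset]
  have hmap : (volume : Measure E).map A = volume := A.measurePreserving.map_eq
  have happ := MeasurableEquiv.map_apply (μ := (volume : Measure E))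
    A.toHomeomorph.toMeasurableEquiv (Ioo (0 : ℝ) 1 • (((↑) : sphere (0 : E) 1 → E) '' s))
  rw [Homeomorph.toMeasurableEquiv_coe, LinearIsometryEquiv.coe_toHomeomorph, hmap] at happ
  exact happ.symm

end Sphere0

/-! ## §1 Hemisphere confinement of the kicker's shadow -/

section Confinement

variable {E : Type*} [NormedAddCommGroup E] [InnerProductSpace ℝ E]

/-- **Hemisphere confinement.** If the shadow centre `c` (position of the third body relative to
the would-be partner, in units of the diameter) satisfies `⟪c, n⟫ ≥ 1` for a unit vector `n`, then
every unit impact vector `ω` shadowed by it (`‖ω - c‖ < 1`, hard-core overlap) lies in the open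
hemisphere `⟪ω, n⟫ > 0`. Proof: `‖ω - c‖² < 1` gives `2⟪ω, c⟫ > ‖c‖²`; with `c = a n + p`,
`a = ⟪c,n⟫ ≥ 1`, `p ⊥ n`: `2a⟪ω,n⟫ > a² + ‖p‖² - 2‖p‖ ≥ a² - 1 ≥ 0`. [folklore] -/
theorem inner_pos_of_mem_shadow {n c ω : E} (hn : ‖n‖ = 1) (hω : ‖ω‖ = 1) (hc : 1 ≤ ⟪c, n⟫_ℝ)
    (h : ‖ω - c‖ < 1) : 0 < ⟪ω, n⟫_ℝ := by
  set a : ℝ := ⟪c, n⟫_ℝ with ha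
  set p : E := c - a • n with hp
  have hpn : ⟪p, n⟫_ℝ = 0 := by
    rw [hp, inner_sub_left, real_inner_smul_left, real_inner_self_eq_norm_sq, hn]
    simp [ha]
  have hcdecomp : c = a • n + p := by rw [hp]; abel
  -- ‖c‖² = a² + ‖p‖²
  have hc2 : ‖c‖ ^ 2 = a ^ 2 + ‖p‖ ^ 2 := by
    have hnp : ⟪n, p⟫_ℝ = 0 := by rw [real_inner_comm]; exact hpn
    rw [hcdecomp, norm_add_sq_real, real_inner_smul_left, hnp, norm_smul, mul_pow, Real.norm_eq_abs,
      sq_abs, hn]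
    ring
  -- ⟪ω, c⟫ = a ⟪ω, n⟫ + ⟪ω, p⟫ and ⟪ω, p⟫ ≤ ‖p‖
  have hωc : ⟪ω, c⟫_ℝ = a * ⟪ω, n⟫_ℝ + ⟪ω, p⟫_ℝ := by
    rw [hcdecomp, inner_add_right, real_inner_smul_right]
  have hωp : ⟪ω, p⟫_ℝ ≤ ‖p‖ := by
    have := real_inner_le_norm ω p
    rw [hω, one_mul] at this
    exact this
  -- ‖ω - c‖² = 1 - 2⟪ω,c⟫ + ‖c‖² < 1
  have hsq : ‖ω - c‖ ^ 2 < 1 := by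
    have h0 : 0 ≤ ‖ω - c‖ := norm_nonneg _
    nlinarith
  have hexp : ‖ω - c‖ ^ 2 = ‖ω‖ ^ 2 - 2 * ⟪ω, c⟫_ℝ + ‖c‖ ^ 2 := norm_sub_sq_real ω c
  rw [hexp, hω, hc2, hωc] at hsq
  -- 2a⟪ω,n⟫ > a² + ‖p‖² - 2⟪ω,p⟫ ≥ a² + ‖p‖² - 2‖p‖ ≥ a² - 1 ≥ 0
  have hkey : 0 < a * ⟪ω, n⟫_ℝ := by nlinarith [sq_nonneg (‖p‖ - 1), norm_nonneg p]
  have ha1 : 0 < a := lt_of_lt_of_le one_pos hc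
  by_contra hle
  push_neg at hle
  nlinarith [mul_nonneg ha1.le (neg_nonneg.2 hle)]

/-- **Cone lemma, receding leg** (the kicker after the kick, including the STATIC cap at `s = 0`):
the comet centre `C(s) = n + u•(v - u') + s•(w - u')`, `s ∈ [-u, 0]`, has `⟪C(s), n⟫ ≥ 1` as soon
as `⟪v - u', n⟫ ≥ 0` (automatic: the kicker recedes) and `⟪v - w, n⟫ ≥ 0` (first cone condition).
Here `n` = contact vector of the kick, `v` = post-kick velocity of the kicked sphere, `u'` = post-kick
velocity of the kicker, `w` = velocity of the next partner, `u` = age of the flight, `-s` = look-back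
time along the next partner's straight backward flight; units `ε = 1`. [folklore] -/
theorem one_le_inner_comet_receding {n v w u' : E} (hn : ‖n‖ = 1) {u s : ℝ} (hu : 0 ≤ u)
    (hs : -u ≤ s) (hs0 : s ≤ 0) (hrec : 0 ≤ ⟪v - u', n⟫_ℝ) (hcone₁ : 0 ≤ ⟪v - w, n⟫_ℝ) :
    1 ≤ ⟪n + u • (v - u') + s • (w - u'), n⟫_ℝ := by
  have hvw : ⟪w - u', n⟫_ℝ = ⟪v - u', n⟫_ℝ - ⟪v - w, n⟫_ℝ := by
    rw [← inner_sub_left]; congr 1; abel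
  rw [inner_add_left, inner_add_left, real_inner_smul_left, real_inner_smul_left,
    real_inner_self_eq_norm_sq, hn, hvw]
  nlinarith [mul_nonneg (by linarith : 0 ≤ u + s) hrec, mul_nonneg (by linarith : 0 ≤ -s) hcone₁]

/-- **Cone lemma, incoming leg** (the kicker before the kick): the comet centre
`C(s) = n + u•(v - uk) + s•(w - uk)`, `s ≤ -u`, has `⟪C(s), n⟫ ≥ 1` as soon as `⟪v - w, n⟫ ≥ 0`
(first cone condition) and `⟪uk - w, n⟫ ≥ 0` (second cone condition; `uk` = PRE-kick velocity of
the kicker, read off the earlier velocity snapshot of the typed past). [folklore] -/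
theorem one_le_inner_comet_incoming {n v w uk : E} (hn : ‖n‖ = 1) {u s : ℝ} (hu : 0 ≤ u)
    (hs : s ≤ -u) (hcone₁ : 0 ≤ ⟪v - w, n⟫_ℝ) (hcone₂ : 0 ≤ ⟪uk - w, n⟫_ℝ) :
    1 ≤ ⟪n + u • (v - uk) + s • (w - uk), n⟫_ℝ := by
  have hvw : ⟪v - uk, n⟫_ℝ = ⟪v - w, n⟫_ℝ - ⟪uk - w, n⟫_ℝ := by
    rw [← inner_sub_left]; congr 1; abel
  have hwk : ⟪w - uk, n⟫_ℝ = -⟪uk - w, n⟫_ℝ := by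
    rw [← inner_neg_left]; congr 1; abel
  rw [inner_add_left, inner_add_left, real_inner_smul_left, real_inner_smul_left,
    real_inner_self_eq_norm_sq, hn, hvw, hwk]
  nlinarith [mul_nonneg hu hcone₁, mul_nonneg (by linarith : 0 ≤ -(u + s)) hcone₂]

/-- **The kicker recedes** (the hypothesis `hrec` of the receding leg is automatic): in the elastic
kick along the unit contact vector `n = x_i - x_k` with pre-velocities `(v₁, uk)`,
`⟪uk - v₁, n⟫ > 0` (incoming), the post-velocities `v = v₁ + a•n`, `u' = uk - a•n`,
`a = ⟪uk - v₁, n⟫`, satisfy `⟪v - u', n⟫ = a > 0`. [folklore] -/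
theorem inner_post_sub_post_eq {n v₁ uk : E} (hn : ‖n‖ = 1) :
    ⟪(v₁ + ⟪uk - v₁, n⟫_ℝ • n) - (uk - ⟪uk - v₁, n⟫_ℝ • n), n⟫_ℝ = ⟪uk - v₁, n⟫_ℝ := by
  have h : (v₁ + ⟪uk - v₁, n⟫_ℝ • n) - (uk - ⟪uk - v₁, n⟫_ℝ • n) =
      (2 * ⟪uk - v₁, n⟫_ℝ) • n - (uk - v₁) := by
    rw [two_mul, add_smul]; abel
  rw [h, inner_sub_left, real_inner_smul_left, real_inner_self_eq_norm_sq, hn]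
  ring

/-- **Confinement of the whole comet** (receding leg; the incoming leg is identical with
`one_le_inner_comet_incoming`): every unit impact vector of the next collision shadowed by the
kicker at some look-back time `s ∈ [-u, 0]` lies in the hemisphere `⟪ω, n⟫ > 0`. [folklore] -/
theorem inner_pos_of_shadowed_receding {n v w u' ω : E} (hn : ‖n‖ = 1) (hω : ‖ω‖ = 1) {u s : ℝ}
    (hu : 0 ≤ u) (hs : -u ≤ s) (hs0 : s ≤ 0) (hrec : 0 ≤ ⟪v - u', n⟫_ℝ) (hcone₁ : 0 ≤ ⟪v - w, n⟫_ℝ)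
    (hshadow : ‖ω - (n + u • (v - u') + s • (w - u'))‖ < 1) : 0 < ⟪ω, n⟫_ℝ :=
  inner_pos_of_mem_shadow hn hω (one_le_inner_comet_receding hn hu hs hs0 hrec hcone₁) hshadow

theorem inner_pos_of_shadowed_incoming {n v w uk ω : E} (hn : ‖n‖ = 1) (hω : ‖ω‖ = 1) {u s : ℝ}
    (hu : 0 ≤ u) (hs : s ≤ -u) (hcone₁ : 0 ≤ ⟪v - w, n⟫_ℝ) (hcone₂ : 0 ≤ ⟪uk - w, n⟫_ℝ)
    (hshadow : ‖ω - (n + u • (v - uk) + s • (w - uk))‖ < 1) : 0 < ⟪ω, n⟫_ℝ :=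
  inner_pos_of_mem_shadow hn hω (one_le_inner_comet_incoming hn hu hs hcone₁ hcone₂) hshadow

end Confinement

/-! ## §2 Mirror-odd zonal kick tests are admissible (zero flux-mean) -/

section OddTests

variable {E : Type*} [NormedAddCommGroup E] [InnerProductSpace ℝ E] [FiniteDimensional ℝ E]
  [MeasurableSpace E] [BorelSpace E]

/-- **Zero flux-mean of mirror-odd zonal tests.** For a continuous ODD profile `G` and `m ⊥ b`,
`∫ G(⟪ω, m⟫) (⟪b, ω⟫)₊ dσ(ω) = 0`: the reflection in `m^⊥` fixes `b`, flips `⟪ω, m⟫`, preserves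
the surface measure. With `m = m(v,w)` normal to the collision plane `span(v,w)` and `b = w - v`
this makes `g(ω,v,w) = ψ(v,w) G(⟪ω, m(v,w)⟫)` an admissible kick test of `KickIsotropyInfo` for
every continuous bounded `ψ` — in particular for the odd profile with a dead band
`G(x) = -sign(x)(|x| - sin α)₊` used by the card. [folklore] -/
theorem integral_oddZonal_mul_posPart_inner_eq_zero (G : ℝ → ℝ) (hG : Continuous G)
    (hodd : ∀ x, G (-x) = -G x) (b m : E) (hmb : ⟪m, b⟫_ℝ = 0) :
    ∫ ω : sphere (0 : E) 1, G ⟪(ω : E), m⟫_ℝ * max ⟪b, (ω : E)⟫_ℝ 0 ∂sphereMeasure = 0 := by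
  set A : E ≃ₗᵢ[ℝ] E := (ℝ ∙ m)ᗮ.reflection with hA
  have hAm : A m = -m := Submodule.reflection_orthogonalComplement_singleton_eq_neg m
  have hAb : A b = b := by
    apply Submodule.reflection_mem_subspace_eq_self
    rw [Submodule.mem_orthogonal_singleton_iff_inner_left]
    rwa [real_inner_comm]
  set f : sphere (0 : E) 1 → ℝ := fun ω => G ⟪(ω : E), m⟫_ℝ * max ⟪b, (ω : E)⟫_ℝ 0 with hf_def
  have hf : Continuous f :=
    (hG.comp (continuous_subtype_val.inner continuous_const)).mul
      ((continuous_const.inner continuous_subtype_val).max continuous_const)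
  have hfodd : ∀ ω, f (sphereMap A ω) = -f ω := by
    intro ω
    have h1 : ⟪(A ω : E), m⟫_ℝ = -⟪(ω : E), m⟫_ℝ := by
      rw [← A.inner_map_map (A ω) m, Submodule.reflection_reflection, hAm, inner_neg_right]
    have h2 : ⟪b, (A ω : E)⟫_ℝ = ⟪b, (ω : E)⟫_ℝ := by
      rw [← A.inner_map_map b (A ω), Submodule.reflection_reflection, hAb]
    simp only [hf_def, coe_sphereMap, h1, h2, hodd]
    ring
  have hmapint := integral_map (μ := (sphereMeasure : Measure (sphere (0 : E) 1)))
    (measurable_sphereMap A).aemeasurable (f := f) hf.aestronglyMeasurable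
  rw [sphereMeasure_map_sphereMap] at hmapint
  have hneg : ∫ ω, f (sphereMap A ω) ∂sphereMeasure = -∫ ω, f ω ∂sphereMeasure := by
    simp_rw [hfodd]
    exact integral_neg f
  change ∫ ω, f ω ∂sphereMeasure = 0
  linarith

/-- The card's odd profile with dead band `x₀ = sin α`: `G(x) = -sign(x) (|x| - x₀)₊`, written as
`min (x₀ - x) 0 + max (-x₀ - x) 0`... concretely `G x = -(max (x - x₀) 0) + max (-x - x₀) 0`. -/
def oddBandProfile (x₀ x : ℝ) : ℝ := -(max (x - x₀) 0) + max (-x - x₀) 0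

theorem continuous_oddBandProfile (x₀ : ℝ) : Continuous (oddBandProfile x₀) := by
  unfold oddBandProfile; fun_prop

theorem oddBandProfile_neg (x₀ x : ℝ) : oddBandProfile x₀ (-x) = -oddBandProfile x₀ x := by
  unfold oddBandProfile; rw [neg_neg]; ring

/-- On the confinement side `x ≥ -x₀` (with `x₀ ≥ 0`) the profile is `≤ 0`: removing shadowed flux
there can only RAISE the conditional mean of the test — the sign-definiteness used by the card. -/
theorem oddBandProfile_nonpos {x₀ x : ℝ} (hx₀ : 0 ≤ x₀) (hx : -x₀ ≤ x) : oddBandProfile x₀ x ≤ 0 := by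
  unfold oddBandProfile
  have h2 : max (-x - x₀) 0 = 0 := max_eq_right (by linarith)
  rw [h2, add_zero, neg_nonpos]
  exact le_max_right _ _

/-- The card's kick test family is admissible: zero flux-mean for every `(v, w)` once the axis field
is orthogonal to the relative velocity (`m(v,w) ⊥ w - v`, e.g. the normal of `span(v,w)`). -/
theorem zeroFluxMean_oddBand (x₀ : ℝ) (ψ : V3 → V3 → ℝ) (m : V3 → V3 → V3)
    (hm : ∀ v w, ⟪m v w, w - v⟫_ℝ = 0) (v w : V3) :
    ∫ ω : sphere (0 : V3) 1, (ψ v w * oddBandProfile x₀ ⟪(ω : V3), m v w⟫_ℝ) *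
      hardSphereKernel (w, v) ω ∂sphereMeasure = 0 := by
  have hker : ∀ ω : sphere (0 : V3) 1, hardSphereKernel (w, v) ω = max ⟪w - v, (ω : V3)⟫_ℝ 0 :=
    fun ω => rfl
  simp_rw [hker, mul_assoc, integral_const_mul]
  rw [integral_oddZonal_mul_posPart_inner_eq_zero (oddBandProfile x₀) (continuous_oddBandProfile x₀)
    (oddBandProfile_neg x₀) (w - v) (m v w) (hm v w), mul_zero]

end OddTests

/-! ## §3 First lemma of the `H`-construction: the pair Palm / Campbell identity (TYPED) -/

/-- **Pair collision-sum Palm identity under the invariant Gibbs law** (Campbell + suspension of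
the flow over its collision section; CIP 1994 App. 4.A special-flow representation). For the
canonical Gibbs law `μ_N` with constant profiles (flow-invariant:
`Theorems.measurePreserving_flow_localGibbsLaw_const`), every `T > 0`, every old sphere `i : Fin N`
and every measurable `F ≥ 0` on phase space, the `μ_N`-expected sum of `F(Φ_s z)` over the collision
instants `s ∈ (0, T]` of the pair `(i, last)` (trajectories are right-continuous, so `Φ_s z` is the
OUTGOING contact configuration) equals `T` times the outgoing-flux integral of `ρ_N · F` over the
contact chart of the pair, in the coordinates of `HardSphereBoundaryFluxEq.lintegral_eq_boundaryFlux`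
(`ν` the unit contact vector from `i` to the new sphere, `w` its velocity, flux weight
`ε² ⟪w - v_i, ν⟫₊`). This is step (a)+(b) of the disprover's roadmap (Disproof.lean F8) with a
past-INDEPENDENT mark; past-dependent marks `F ∘ (backward flow)` are covered because `F` is any
measurable function of the phase point. UNPROVED here (first lemma of the line, to be proved from
invariance + the chart + local finiteness of collisions on `Φ.good`). -/
def PairCollisionPalmIdentity : Prop :=
  ∀ (σ : ℝ), 0 < σ → σ < 2⁻¹ → ∀ (N : ℕ) (Φ : Flow σ N) (i : Fin N)
    (F : Config (N + 1) (Fin 3) T3 → ℝ≥0∞), Measurable F → ∀ T : ℝ, 0 < T →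
    let ε := hsDiameter σ N
    let G : Literature.Analysis.FluidPDE.Geometry (Fin 3) T3 := Literature.Analysis.FluidPDE.Torus.geometry (Fin 3)
    let μ := localGibbsLaw σ (fun _ => 1) (fun _ => 0) (fun _ => 1) N Φ
    let ρ : Config (N + 1) (Fin 3) T3 → ℝ≥0∞ := fun z =>
      ENNReal.ofReal (canonicalDensity G ε (N + 1) (localGibbsProfile (fun _ => 1) (fun _ => 0) (fun _ => 1)) z)
    ∫⁻ z, (∑ᶠ (s : ℝ) (_ : s ∈ Ioc 0 T ∧ Φ.flow s z ∈ contactSet G (N + 1) ε (Fin.castAdd 1 i) (Fin.last N)),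
        F (Φ.flow s z)) ∂μ =
      ENNReal.ofReal T *
        ∫⁻ W' : Config N (Fin 3) T3, ∫⁻ w : V3, ∫⁻ ν : sphere (0 : V3) 1,
          ENNReal.ofReal (ε ^ 2 * ⟪w - (W' i).2, (ν : V3)⟫_ℝ) *
            (ρ * F) (appendParticle W' ((W' i).1 + Literature.Analysis.FunctionSpaces.Torus.proj (ε • (ν : V3))) w)
          ∂sphereMeasure

end

end Summit.AtomisticToContinuum.HydrodynamicLimit.Cruxes.KickIsotropyInfo.OddParity
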